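import Mathlib
import Summits.NavierStokesRegularity.NavierStokesRegularity.Theorems.TypeIQuarterGateScarEnvelopeTypeISatelliteTowerGalleryMinRate
import Summits.NavierStokesRegularity.NavierStokesRegularity.Theorems.TypeIQuarterGateScarEnvelopeTypeISatelliteTowerGalleryRootOmega

/-!
# An EXACT, GLOBALLY EQUI-RATED minimiser exists in the gallery of every rooted A–B object

For a ROOTED A–B object `(U, P, H)` of rate `M` let `m⋆` be the minimal tight rate of the scars of
the A–B gallery limits of `U` (attained, `ABTower.exists_galleryMinimiser_of_rooted`, module
`…SatelliteTowerGalleryMinRate`).  Zooming into the root of an attained minimiser along any null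
sequence and passing to a root ω-limit spreads the unit-cylinder rate `m⋆` over the WHOLE open past:
there is an A–B gallery limit `W⋆` of `U` with budget `𝐈(W⋆) ≤ 4·𝐈(U)` which is

* ROOTED (the root scar persists, A–B Prop. 2.3),
* GLOBALLY `m⋆`-RATED: `‖W⋆(t,x)‖ ≤ m⋆/√(−t)` for all `t < 0`, `x` — i.e. `W⋆` lies in the class
  `ABTower m⋆` of its own minimal scar rate (`m⋆ ≤ tightRate U 0 ≤ M`),
* EXACTLY EQUI-RATED: every scar of `W⋆` has tight rate exactly `m⋆`, and every scar of every A–B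
  gallery limit of `U` has tight rate `≥ m⋆`.

This is the phase-space statement (L12) `OmegaOfMinimiserGlobal` of the crux idea
`Cruxes/ScarEnvelopeTypeI/Ideas/zoom-recurrence.md` (ns-idea-17 g0) in its load-bearing part, and
the gallery-wise, UNCONDITIONAL form of nsreg-p3's `ExactMin` / equi-rated normal form (ROUND-34 N6,
ROUND-37/38: class-wide it needs the OPEN (S∞) `MinSingRateAttained`; inside one gallery the budget is
uniform and nothing is assumed).

HONEST FRAMING: a compactness / normal-form theorem about hypothetical Type-I ancient objects for
the crux `TypeIQuarterGate.ScarEnvelopeTypeI` (item 23843); nothing open is proved — 23843,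
`∀ M, ¬ OneScarLeaf M`, `∀ M, ¬ InfiniteDescent M`, the class-wide (S∞), the route and Navier–Stokes
regularity are OPEN.  LEAD-lineage prover ns-sz-p1 g6; `--supports stmt-NavierStokesRegularity-23843
--as helper`.
-/

noncomputable section

-- the summit-side namespace repeats a component by design (single-conjunct summit, D-0017)
set_option linter.dupNamespace false

open MeasureTheory Set Metric Filter Topology
open scoped ENNReal

namespace Summit.NavierStokesRegularity.NavierStokesRegularity.Cruxes.ScarEnvelopeTypeI.ZoomDictionary

section GalleryExactMin

open Literature.Analysis.FluidPDE
variable {U W : ℝ → (EuclideanSpace ℝ (Fin 3)) → (EuclideanSpace ℝ (Fin 3))}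
  {P : ℝ → (EuclideanSpace ℝ (Fin 3)) → ℝ}

/-- **A unit-cylinder rate spreads under root zooms**: if `√(−s)‖W(s,z)‖ ≤ m` on
`(−1,0) × B(0,1)` and `0 < l`, `l·R ≤ 1`, then the root zoom `zoom W 0 0 l` obeys the same rate
EVERYWHERE on `(−R², 0) × B(0, R)`. -/
theorem rate_rootZoom_of_unitRate {m : ℝ}
    (h : ∀ s ∈ Ioo (-((1 : ℝ) ^ 2)) 0, ∀ z ∈ ball (0 : (EuclideanSpace ℝ (Fin 3))) 1,
      Real.sqrt (-s) * ‖W s z‖ ≤ m)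
    {l R : ℝ} (hl : 0 < l) (hR : 0 < R) (hlR : l * R ≤ 1) :
    ∀ s ∈ Ioo (-(R ^ 2)) 0, ∀ z ∈ ball (0 : (EuclideanSpace ℝ (Fin 3))) R,
      Real.sqrt (-s) * ‖zoom W 0 0 l s z‖ ≤ m := by
  intro s hs z hz
  have hl2 : 0 < l ^ 2 := pow_pos hl 2
  have hlR2 : l ^ 2 * R ^ 2 ≤ 1 := by nlinarith [mul_pos hl hR]
  have ht : 0 + l ^ 2 * s ∈ Ioo (-((1 : ℝ) ^ 2)) 0 := by
    rw [zero_add, one_pow]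
    constructor <;> nlinarith [hs.1, hs.2]
  have hx : (0 : (EuclideanSpace ℝ (Fin 3))) + l • z ∈ ball (0 : (EuclideanSpace ℝ (Fin 3))) 1 := by
    rw [zero_add, mem_ball_zero_iff, norm_smul, Real.norm_of_nonneg hl.le]
    have hz' : ‖z‖ < R := by rwa [mem_ball_zero_iff] at hz
    nlinarith
  have h1 := h _ ht _ hx
  have hsq : Real.sqrt (-(0 + l ^ 2 * s)) = l * Real.sqrt (-s) := by
    rw [zero_add, show -(l ^ 2 * s) = l ^ 2 * (-s) by ring, Real.sqrt_mul (sq_nonneg _),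
      Real.sqrt_sq hl.le]
  rw [hsq] at h1
  simp only [zoom, norm_smul, Real.norm_of_nonneg hl.le]
  calc Real.sqrt (-s) * (l * ‖W (0 + l ^ 2 * s) (0 + l • z)‖)
      = l * Real.sqrt (-s) * ‖W (0 + l ^ 2 * s) (0 + l • z)‖ := by ring
    _ ≤ m := h1

/-- **Root ω-limits of a unit-rated field are GLOBALLY rated**: if `√(−s)‖W₁‖ ≤ m` on the unit
cylinder and `W` is a root ω-limit of `W₁`, then `√(−t)‖W‖ ≤ m` a.e. on every `Q_R(0)`. -/
theorem globalRate_ae_of_isRootOmegaLimit {W₁ : ℝ → (EuclideanSpace ℝ (Fin 3)) → (EuclideanSpace ℝ (Fin 3))}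
    {m : ℝ}
    (h : ∀ s ∈ Ioo (-((1 : ℝ) ^ 2)) 0, ∀ z ∈ ball (0 : (EuclideanSpace ℝ (Fin 3))) 1,
      Real.sqrt (-s) * ‖W₁ s z‖ ≤ m)
    (hW₁ : ∀ R : ℝ, 0 < R → AEStronglyMeasurable (Function.uncurry W₁)
      (volume.restrict (parabolicCylinder R (0 : ℝ × (EuclideanSpace ℝ (Fin 3))))))
    (hW : IsRootOmegaLimit W₁ W) {R : ℝ} (hR : 0 < R) :
    ∀ᵐ z ∂(volume.restrict (parabolicCylinder R (0 : ℝ × (EuclideanSpace ℝ (Fin 3))))),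
      Real.sqrt (-z.1) * ‖W z.1 z.2‖ ≤ m := by
  obtain ⟨hW3, l, hl, hl0, hconv⟩ := hW
  have hmeas : ∀ j, AEStronglyMeasurable (Function.uncurry (zoom W₁ 0 0 (l j)))
      (volume.restrict (parabolicCylinder R (0 : ℝ × (EuclideanSpace ℝ (Fin 3))))) := fun j =>
    aestronglyMeasurable_uncurry_zoom hW₁ 0 (hl j) hR
  obtain ⟨ψ, hψ, hae⟩ := exists_subseq_tendsto_ae₃ hmeas (hW3 R hR).1 (hconv R hR)
  -- eventually `l (ψ j) · R ≤ 1`, whence the zooms obey the rate everywhere on `Q_R(0)`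
  have hev : ∀ᶠ j in atTop, l (ψ j) * R ≤ 1 := by
    have h1 : Tendsto (fun j => l (ψ j) * R) atTop (𝓝 (0 * R)) :=
      (hl0.comp hψ.tendsto_atTop).mul_const R
    rw [zero_mul] at h1
    exact h1.eventually (ge_mem_nhds one_pos)
  filter_upwards [hae, ae_restrict_mem (isOpen_parabolicCylinder R
    (0 : ℝ × (EuclideanSpace ℝ (Fin 3)))).measurableSet] with z hz hzmem
  rw [mem_parabolicCylinder] at hzmem
  obtain ⟨⟨h1, h2⟩, h3⟩ := hzmem
  simp only [Prod.fst_zero, Prod.snd_zero, zero_sub] at h1 h2 h3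
  refine le_of_tendsto (hz.norm.const_mul (Real.sqrt (-z.1))) ?_
  filter_upwards [hev] with j hj
  exact rate_rootZoom_of_unitRate h (hl _) hR hj z.1 ⟨h1, h2⟩ z.2 h3

/-- **AN EXACT, GLOBALLY EQUI-RATED MINIMISER IN THE GALLERY OF EVERY ROOTED A–B OBJECT.**
For a rooted A–B object `(U, P, H)` of rate `M` there are `m⋆ ≤ tightRate U 0` and an A–B
gallery limit `W⋆` of `U` with budget `≤ 4·𝐈(U)`, rooted, lying in the class `ABTower m⋆` of its own
root rate (`‖W⋆(t,x)‖ ≤ m⋆/√(−t)` on the whole open past), all of whose scars have tight rate EXACTLY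
`m⋆`, while every scar of every A–B gallery limit of `U` has tight rate `≥ m⋆`. -/
theorem ABTower.exists_galleryExactMinimiser {M : ℝ}
    {H : ℝ → (EuclideanSpace ℝ (Fin 3)) → (EuclideanSpace ℝ (Fin 3)) →L[ℝ] (EuclideanSpace ℝ (Fin 3))}
    (h : ABTower M U P H) (h0 : ¬ RegPt U 0) :
    ∃ (W : ℝ → (EuclideanSpace ℝ (Fin 3)) → (EuclideanSpace ℝ (Fin 3))) (P' : ℝ → (EuclideanSpace ℝ (Fin 3)) → ℝ)
      (H' : ℝ → (EuclideanSpace ℝ (Fin 3)) → (EuclideanSpace ℝ (Fin 3)) →L[ℝ] (EuclideanSpace ℝ (Fin 3)))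
      (m : ℝ),
      ABTower M W P' H' ∧ ABTower m W P' H' ∧ IsGalleryLimit U W ∧
      typeIBound (Iio (0 : ℝ) ×ˢ univ) W P' H' ≤ 4 * typeIBound (Iio (0 : ℝ) ×ˢ univ) U P H ∧
      ¬ RegPt W 0 ∧ m ≤ tightRate U 0 ∧ tightRate W 0 = m ∧
      (∀ y : (EuclideanSpace ℝ (Fin 3)), ¬ RegPt W y → tightRate W y = m) ∧
      ∀ (W₂ : ℝ → (EuclideanSpace ℝ (Fin 3)) → (EuclideanSpace ℝ (Fin 3))) (P₂ : ℝ → (EuclideanSpace ℝ (Fin 3)) → ℝ)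
        (H₂ : ℝ → (EuclideanSpace ℝ (Fin 3)) → (EuclideanSpace ℝ (Fin 3)) →L[ℝ] (EuclideanSpace ℝ (Fin 3)))
        (y₂ : (EuclideanSpace ℝ (Fin 3))),
        ABTower M W₂ P₂ H₂ → IsGalleryLimit U W₂ → ¬ RegPt W₂ y₂ → m ≤ tightRate W₂ y₂ := by
  -- ## an attained minimiser `W₁`, rate `m⋆ := tightRate W₁ 0` on the unit cylinder
  obtain ⟨W₁, P₁, H₁, hW₁, hg₁, -, hs₁, hle₁, hr₁, hmin₁⟩ := h.exists_galleryMinimiser_of_rooted h0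
  set m : ℝ := tightRate W₁ 0 with hmdef
  -- ## a root ω-limit `W₂` of `W₁` along the scales `1/(j+1)`
  have hl : ∀ j : ℕ, (0 : ℝ) < 1 / ((j : ℝ) + 1) := fun j => by positivity
  obtain ⟨W₂, P₂, H₂, σ, -, hW₂, -, hω₂, -⟩ :=
    hW₁.exists_isRootOmegaLimit hl tendsto_one_div_add_atTop_nhds_zero_nat
  -- rooted (persistence) and a gallery limit of `U` (transitivity)
  obtain ⟨W₂', P₂', H₂', hW₂', -, hae₂, hs₂'⟩ := abTower_of_isRootOmegaLimit hW₁ hs₁ hω₂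
  have hg₂ : IsGalleryLimit U W₂ :=
    hg₁.trans (fun R hR => h.aestronglyMeasurable_uncurry hR) hω₂.isGalleryLimit
  have hs₂ : ¬ RegPt W₂ 0 := fun hr => hs₂' (regPt_zero_of_ae_eq hr hae₂)
  -- globally `m`-rated, a.e. on every `Q_R(0)`
  have hrate₂ : ∀ R : ℝ, 0 < R →
      ∀ᵐ z ∂(volume.restrict (parabolicCylinder R (0 : ℝ × (EuclideanSpace ℝ (Fin 3))))),
        Real.sqrt (-z.1) * ‖W₂ z.1 z.2‖ ≤ m := fun R hR =>
    globalRate_ae_of_isRootOmegaLimit hr₁ (fun R hR => hW₁.aestronglyMeasurable_uncurry hR) hω₂ hR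
  -- ## the A–B representative `W` of budget `≤ 4 𝐈(U)`
  obtain ⟨W, PW, HW, hWAB, hWI, hWae⟩ := abTower_of_isGalleryLimit h hg₂
  have hWg : IsGalleryLimit U W := hg₂.congr_ae hWae
  have hWs : ¬ RegPt W 0 := fun hr =>
    hs₂ (regPt_zero_of_ae_eq hr fun R hR => (hWae R hR).mono fun z hz => hz.symm)
  have hWcont : ContinuousOn (Function.uncurry W) (Iio 0 ×ˢ univ) := (towerObj_of_abTower hWAB).2.1
  have hWrateR : ∀ R : ℝ, 0 < R → ∀ t ∈ Ioo (-(R ^ 2)) 0, ∀ x ∈ ball (0 : (EuclideanSpace ℝ (Fin 3))) R,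
      Real.sqrt (-t) * ‖W t x‖ ≤ m := by
    intro R hR
    refine rate_everywhere_of_ae hWcont ?_
    filter_upwards [hrate₂ R hR, hWae R hR] with z hz hzz
    rw [← hzz]
    exact hz
  have hWdec : HasTypeITimeDecay m W := by
    intro t ht x
    -- choose `R` with `(t, x) ∈ (−R², 0) × B(0, R)`
    set R : ℝ := Real.sqrt (-t) + ‖x‖ + 1 with hRdef
    have hR : 0 < R := by rw [hRdef]; positivity
    have hst : 0 < Real.sqrt (-t) := Real.sqrt_pos.2 (neg_pos.2 ht)
    have h1 := hWrateR R hR t ⟨?_, ht⟩ x ?_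
    · rwa [le_div_iff₀ hst, mul_comm]
    · have hsq : Real.sqrt (-t) ^ 2 = -t := Real.sq_sqrt (neg_pos.2 ht).le
      have : Real.sqrt (-t) < R := by rw [hRdef]; linarith [norm_nonneg x]
      nlinarith [Real.sqrt_nonneg (-t)]
    · rw [mem_ball_zero_iff, hRdef]
      linarith [Real.sqrt_nonneg (-t)]
  have hWABm : ABTower m W PW HW :=
    ⟨⟨hWAB.1.1, hWAB.1.2.1, hWAB.1.2.2.1, hWdec⟩, hWAB.2.1, hWAB.2.2.1, hWAB.2.2.2⟩
  -- ## the rates: `≤ m` everywhere by the global decay, `≥ m` at every gallery scar by minimality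
  have hmin : ∀ (W₃ : ℝ → (EuclideanSpace ℝ (Fin 3)) → (EuclideanSpace ℝ (Fin 3)))
      (P₃ : ℝ → (EuclideanSpace ℝ (Fin 3)) → ℝ)
      (H₃ : ℝ → (EuclideanSpace ℝ (Fin 3)) → (EuclideanSpace ℝ (Fin 3)) →L[ℝ] (EuclideanSpace ℝ (Fin 3)))
      (y₃ : (EuclideanSpace ℝ (Fin 3))),
      ABTower M W₃ P₃ H₃ → IsGalleryLimit U W₃ → ¬ RegPt W₃ y₃ → m ≤ tightRate W₃ y₃ := hmin₁
  have hscar : ∀ y : (EuclideanSpace ℝ (Fin 3)), ¬ RegPt W y → tightRate W y = m := fun y hy =>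
    le_antisymm (tightRate_le_of_rateAt (rateAt_of_hasTypeITimeDecay hWdec y)) (hmin W PW HW y hWAB hWg hy)
  refine ⟨W, PW, HW, m, hWAB, hWABm, hWg, hWI, hWs, hle₁, hscar 0 hWs, hscar, hmin⟩

end GalleryExactMin

end Summit.NavierStokesRegularity.NavierStokesRegularity.Cruxes.ScarEnvelopeTypeI.ZoomDictionary
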